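import Summits.BirchSwinnertonDyer.BirchSwinnertonDyer.Theorems.CMKolyvaginAtInertTwoThreadingLemmasAtTwo
import HarnessLib

/-!
# Route `CMKolyvaginAtInertTwo`, crux `CMKolyvaginExactAtInertTwo` (stmt-BirchSwinnertonDyer-24277):
# THE THREADING LEMMA FOR TWO CHAINS (T5′, KERNEL-STATUS §13.5; MEMO-T5prime-threading §3/§7)

Seat `bsd-line-cmk2-p1` g14 (cell `bsd-print-cf2`); helper (`--supports stmt-BirchSwinnertonDyer-24277`).
THEOREMS ONLY: no definition, no named fact, no `sorry`; no item is closed; BSD is not proved by this.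
Pure finite-abelian-group algebra; this is EXACTLY the hypothesis `hthread` of
`exists_liftGroups_of_threading` (`…LiftGroupsTwoSidedAtTwo`, p685868), so with this file the lift
groups of the adaptive telescope at `p = 2` satisfy (IND) for ALL finite symplectic `Ш(E/ℚ)[2^∞]`,
`Ш(E^{(d_K)}/ℚ)[2^∞]` (corollary `exists_liftGroups`, sequel file).

* `exists_threading` — `C` a finite elementary abelian `p`-group, `P, Q : ℕ → Sub(C)` antitone,
  `a, b : ℕ → ℕ` with `#(P_j ∩ Q_i) ≤ p^{a_j} p^{b_i}` for all `j, i`. Then some `Y ≤ C` has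
  `#P_j ≤ p^{a_j} · #(Y ∩ P_j)` for all `j` and `#(Y ∩ Q_i) ≤ p^{b_i}` for all `i`.

Proof (memo §7, basis-free): induction on `#C`. Pick `v ≠ 0` in the smallest non-zero `P`-layer
(so `v ∈ P_j` whenever `P_j ≠ 0`) and pass to `C/⟨v⟩` with the image chains. If some `Q_{i₀} ∋ v` has
`b_{i₀} = 0`, put `v` OUTSIDE `Y`: capacities `a_j − 1` downstairs (the rectangle conditions persist:
the order of `P_j ∩ Q_i` drops by `p` when `v ∈ Q_i`, and when `v ∉ Q_i` one has `Q_i ⊆ Q_{i₀}`,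
`(P_j ∩ Q_i) ⊕ ⟨v⟩ ≤ P_j ∩ Q_{i₀}` of order `≤ p^{a_j}`), and lift `Ȳ` inside a complement of `⟨v⟩`.
Otherwise put `v` INSIDE `Y`: capacities `b_i − 1` for the `i` with `v ∈ Q_i`, lift `Y = mk⁻¹(Ȳ)`.
(The matching/Hall formulation of memo §3 is equivalent; no basis is needed here.)

References: [McCallumLMS1991] §5 (the two maximal isotropic subgroups); folklore (Hall-type threading).
-/

-- single-conjunct summit: `Summit.BirchSwinnertonDyer.BirchSwinnertonDyer.…` repeats the name by design
set_option linter.dupNamespace false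
set_option autoImplicit false

noncomputable section

open AddSubgroup

namespace Summit.BirchSwinnertonDyer.BirchSwinnertonDyer.Theorems.KolyvaginLiftGroupsTwo

universe u

section Threading

/-- **The threading lemma.** For a finite elementary abelian `p`-group `C`, antitone chains
`P, Q : ℕ → AddSubgroup C` and capacities `a, b : ℕ → ℕ` with `#(P j ⊓ Q i) ≤ p^{a j} · p^{b i}`
for all `j, i`, there is `Y ≤ C` with `#(P j) ≤ p^{a j} · #(Y ⊓ P j)` for all `j` and
`#(Y ⊓ Q i) ≤ p^{b i}` for all `i`. [folklore] -/
theorem exists_threading {p : ℕ} (hp : p.Prime) (C : Type u) [AddCommGroup C] [Finite C]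
    (P Q : ℕ → AddSubgroup C) (a b : ℕ → ℕ) (hCp : ∀ c : C, p • c = 0) (hPa : Antitone P)
    (hQa : Antitone Q) (hH : ∀ j i, Nat.card ↥(P j ⊓ Q i) ≤ p ^ a j * p ^ b i) :
    ∃ Y : AddSubgroup C, (∀ j, Nat.card ↥(P j) ≤ p ^ a j * Nat.card ↥(Y ⊓ P j)) ∧
      (∀ i, Nat.card ↥(Y ⊓ Q i) ≤ p ^ b i) := by
  suffices key : ∀ (m : ℕ) (C : Type u) [AddCommGroup C] [Finite C] (P Q : ℕ → AddSubgroup C)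
      (a b : ℕ → ℕ), (∀ c : C, p • c = 0) → Antitone P → Antitone Q →
      (∀ j i, Nat.card ↥(P j ⊓ Q i) ≤ p ^ a j * p ^ b i) → Nat.card C = m →
      ∃ Y : AddSubgroup C, (∀ j, Nat.card ↥(P j) ≤ p ^ a j * Nat.card ↥(Y ⊓ P j)) ∧
        (∀ i, Nat.card ↥(Y ⊓ Q i) ≤ p ^ b i) from key _ C P Q a b hCp hPa hQa hH rfl
  intro m
  induction m using Nat.strong_induction_on with
  | _ m ih =>
  intro C _ _ P Q a b hCp hPa hQa hH hm
  classical
  haveI : Fact p.Prime := ⟨hp⟩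
  have hp1 : 1 ≤ p := hp.one_lt.le
  have hpow : ∀ n : ℕ, 1 ≤ p ^ n := fun n ↦ Nat.one_le_pow _ _ hp.pos
  -- all `P j` trivial: `Y = 0`
  by_cases hall : ∀ j, P j = ⊥
  · refine ⟨⊥, fun j ↦ ?_, fun i ↦ ?_⟩
    · rw [hall j, inf_bot_eq, AddSubgroup.card_bot, mul_one]; exact hpow _
    · rw [bot_inf_eq, AddSubgroup.card_bot]; exact hpow _
  push Not at hall
  -- the smallest non-zero layer `P j₁` and `0 ≠ v ∈ P j₁`
  have hex : ∃ n, ∃ j, P j ≠ ⊥ ∧ Nat.card ↥(P j) = n := by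
    obtain ⟨j, hj⟩ := hall; exact ⟨_, j, hj, rfl⟩
  obtain ⟨j₁, hj₁, hj₁card⟩ := Nat.find_spec hex
  have hmin : ∀ j, P j ≠ ⊥ → Nat.card ↥(P j₁) ≤ Nat.card ↥(P j) := fun j hj ↦ by
    rw [hj₁card]; exact Nat.find_min' hex ⟨j, hj, rfl⟩
  have hcore : ∀ j, P j ≠ ⊥ → P j₁ ≤ P j := by
    intro j hj
    rcases le_or_gt j j₁ with h | h
    · exact hPa h
    · exact (AddSubgroup.eq_of_le_of_card_ge (hPa h.le) (hmin j hj)).symm.le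
  obtain ⟨⟨v, hvP⟩, hv0⟩ := (AddSubgroup.ne_bot_iff_exists_ne_zero).mp hj₁
  have hv : v ≠ 0 := fun h ↦ hv0 (Subtype.ext h)
  have hvPj : ∀ j, P j ≠ ⊥ → v ∈ P j := fun j hj ↦ hcore j hj hvP
  have hpv : p • v = 0 := hCp v
  -- the line `N = ⟨v⟩` and the quotient
  set N : AddSubgroup C := zmultiples v with hN_def
  have hcardN : Nat.card N = p := by rw [hN_def, Nat.card_zmultiples, addOrderOf_eq_prime hpv hv]
  have hNle : ∀ j, P j ≠ ⊥ → N ≤ P j := fun j hj ↦ AddSubgroup.zmultiples_le_of_mem (hvPj j hj)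
  set mk := QuotientAddGroup.mk' N with hmk_def
  haveI : Finite (C ⧸ N) := Finite.of_surjective _ QuotientAddGroup.mk_surjective
  have hCbar : ∀ c : C ⧸ N, p • c = 0 := by
    intro c
    induction c using QuotientAddGroup.induction_on with
    | H x => rw [← QuotientAddGroup.mk_nsmul, hCp, QuotientAddGroup.mk_zero]
  have hcardC : Nat.card (C ⧸ N) * p = Nat.card C := by
    rw [← hcardN]; exact (AddSubgroup.card_eq_card_quotient_mul_card_addSubgroup N).symm
  have hlt : Nat.card (C ⧸ N) < m := by
    rw [← hm, ← hcardC]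
    have := Nat.card_pos (α := C ⧸ N)
    have := hp.one_lt
    nlinarith
  set Pb : ℕ → AddSubgroup (C ⧸ N) := fun j ↦ (P j).map mk with hPb_def
  set Qb : ℕ → AddSubgroup (C ⧸ N) := fun i ↦ (Q i).map mk with hQb_def
  have hPba : Antitone Pb := fun j j' h ↦ AddSubgroup.map_mono (hPa h)
  have hQba : Antitone Qb := fun i i' h ↦ AddSubgroup.map_mono (hQa h)
  -- rectangles downstairs
  have hPbbot : ∀ j, P j = ⊥ → Pb j = ⊥ := fun j hj ↦ by
    show (P j).map mk = ⊥; rw [hj, AddSubgroup.map_bot]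
  have hrect_in : ∀ j i, P j ≠ ⊥ → v ∈ Q i →
      Nat.card ↥(Pb j ⊓ Qb i) * p = Nat.card ↥(P j ⊓ Q i) := by
    intro j i hj hvi
    show Nat.card ↥((P j).map mk ⊓ (Q i).map mk) * p = _
    rw [hmk_def, map_mk_inf_eq_of_le (hNle j hj), ← hcardN]
    exact card_map_mk_mul_card (le_inf (hNle j hj) (AddSubgroup.zmultiples_le_of_mem hvi))
  have hrect_out : ∀ j i, P j ≠ ⊥ → v ∉ Q i →
      Nat.card ↥(Pb j ⊓ Qb i) = Nat.card ↥(P j ⊓ Q i) := by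
    intro j i hj hvi
    show Nat.card ↥((P j).map mk ⊓ (Q i).map mk) = _
    rw [hmk_def, map_mk_inf_eq_of_le (hNle j hj)]
    exact card_map_mk_of_disjoint (disjoint_zmultiples_of_not_mem hp hpv
      (fun h ↦ hvi (AddSubgroup.mem_inf.mp h).2))
  have hrect_bot : ∀ j i, P j = ⊥ → Nat.card ↥(Pb j ⊓ Qb i) = 1 := fun j i hj ↦ by
    rw [hPbbot j hj, bot_inf_eq, AddSubgroup.card_bot]
  -- two cases
  by_cases hcase : ∃ i₀, v ∈ Q i₀ ∧ b i₀ = 0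
  · /- CASE (ii): `v` goes OUTSIDE `Y`; capacities `a j - 1` downstairs -/
    obtain ⟨i₀, hvi₀, hbi₀⟩ := hcase
    have ha1 : ∀ j, P j ≠ ⊥ → 1 ≤ a j := by
      intro j hj
      by_contra h
      push Not at h
      have h0 : a j = 0 := by omega
      have h1 := hH j i₀
      rw [h0, hbi₀, pow_zero, mul_one] at h1
      have h2 : Nat.card N ≤ Nat.card ↥(P j ⊓ Q i₀) :=
        AddSubgroup.card_le_of_le (le_inf (hNle j hj) (AddSubgroup.zmultiples_le_of_mem hvi₀))
      rw [hcardN] at h2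
      have := hp.one_lt
      omega
    have hHb : ∀ j i, Nat.card ↥(Pb j ⊓ Qb i) ≤ p ^ (a j - 1) * p ^ b i := by
      intro j i
      by_cases hj : P j = ⊥
      · rw [hrect_bot j i hj]; exact Nat.one_le_iff_ne_zero.mpr (Nat.mul_ne_zero
          (Nat.pos_iff_ne_zero.mp (hpow _)) (Nat.pos_iff_ne_zero.mp (hpow _)))
      by_cases hvi : v ∈ Q i
      · have h1 := hrect_in j i hj hvi
        have h2 := hH j i
        have h3 : p ^ a j = p ^ (a j - 1) * p := by
          rw [← pow_succ, Nat.sub_add_cancel (ha1 j hj)]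
        rw [← h1, h3] at h2
        have : Nat.card ↥(Pb j ⊓ Qb i) * p ≤ p ^ (a j - 1) * p ^ b i * p := by
          calc _ ≤ p ^ (a j - 1) * p * p ^ b i := h2
            _ = p ^ (a j - 1) * p ^ b i * p := by ring
        exact Nat.le_of_mul_le_mul_right this hp.pos
      · -- `v ∉ Q i`: `(P j ∩ Q i) ⊕ ⟨v⟩ ≤ P j ∩ Q i₀`, of order `≤ p^{a j}`
        rw [hrect_out j i hj hvi]
        have hii₀ : Q i ≤ Q i₀ := by
          rcases le_or_gt i₀ i with h | h
          · exact hQa h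
          · exact absurd (hQa h.le hvi₀) hvi
        have hdisj : Disjoint (P j ⊓ Q i) N :=
          (disjoint_zmultiples_of_not_mem hp hpv (fun h ↦ hvi (AddSubgroup.mem_inf.mp h).2)).symm
        have h1 : Nat.card ↥(P j ⊓ Q i) * p ≤ Nat.card ↥(P j ⊓ Q i₀) := by
          rw [← hcardN, ← card_sup_eq_mul_of_disjoint hdisj]
          exact AddSubgroup.card_le_of_le (sup_le (inf_le_inf_left _ hii₀)
            (le_inf (hNle j hj) (AddSubgroup.zmultiples_le_of_mem hvi₀)))
        have h2 := hH j i₀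
        rw [hbi₀, pow_zero, mul_one, ← Nat.sub_add_cancel (ha1 j hj), pow_succ] at h2
        have h3 : Nat.card ↥(P j ⊓ Q i) ≤ p ^ (a j - 1) := Nat.le_of_mul_le_mul_right (h1.trans h2) hp.pos
        calc Nat.card ↥(P j ⊓ Q i) ≤ p ^ (a j - 1) * 1 := by rw [mul_one]; exact h3
          _ ≤ p ^ (a j - 1) * p ^ b i := Nat.mul_le_mul_left _ (hpow _)
    obtain ⟨Yb, hYbα, hYbβ⟩ := ih _ hlt (C ⧸ N) Pb Qb (fun j ↦ a j - 1) b hCbar hPba hQba hHb rfl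
    -- lift inside a complement `K` of `N`
    obtain ⟨K, hNK⟩ := exists_isCompl_zmultiples_of_prime hp hCp v
    set Y : AddSubgroup C := Yb.comap mk ⊓ K with hY_def
    have hNY : Disjoint N Y := hNK.disjoint.mono_right inf_le_right
    refine ⟨Y, fun j ↦ ?_, fun i ↦ ?_⟩
    · by_cases hj : P j = ⊥
      · rw [hj, inf_bot_eq, AddSubgroup.card_bot, mul_one]; exact hpow _
      have h1 : Nat.card ↥(P j) = Nat.card ↥(Pb j) * p := by
        rw [← hcardN]; exact (card_map_mk_mul_card (hNle j hj)).symm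
      have h2 : Nat.card ↥(Y ⊓ P j) = Nat.card ↥(Yb ⊓ Pb j) := by
        rw [← card_map_mk_of_disjoint (hNY.mono_right inf_le_left), hY_def, hmk_def,
          map_comap_inf_inf_eq hNK.codisjoint (hNle j hj)]
      rw [h1, h2]
      calc Nat.card ↥(Pb j) * p ≤ p ^ (a j - 1) * Nat.card ↥(Yb ⊓ Pb j) * p :=
            Nat.mul_le_mul_right _ (hYbα j)
        _ = p ^ (a j - 1 + 1) * Nat.card ↥(Yb ⊓ Pb j) := by ring
        _ = p ^ a j * Nat.card ↥(Yb ⊓ Pb j) := by rw [Nat.sub_add_cancel (ha1 j hj)]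
    · have h1 : Nat.card ↥(Y ⊓ Q i) = Nat.card ↥((Y ⊓ Q i).map mk) :=
        (card_map_mk_of_disjoint (hNY.mono_right inf_le_left)).symm
      have h2 : (Y ⊓ Q i).map mk ≤ Yb ⊓ Qb i := by
        refine le_inf ?_ (AddSubgroup.map_mono inf_le_right)
        exact (AddSubgroup.map_mono (inf_le_left.trans inf_le_left)).trans (AddSubgroup.map_comap_le _ _)
      rw [h1]
      exact (AddSubgroup.card_le_of_le h2).trans (hYbβ i)
  · /- CASE (i): `v` goes INSIDE `Y`; capacities `b i - 1` for the `i` with `v ∈ Q i` -/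
    push Not at hcase
    have hb1 : ∀ i, v ∈ Q i → 1 ≤ b i := fun i hi ↦ Nat.one_le_iff_ne_zero.mpr (hcase i hi)
    set b' : ℕ → ℕ := fun i ↦ if v ∈ Q i then b i - 1 else b i with hb'_def
    have hHb : ∀ j i, Nat.card ↥(Pb j ⊓ Qb i) ≤ p ^ a j * p ^ b' i := by
      intro j i
      by_cases hj : P j = ⊥
      · rw [hrect_bot j i hj]; exact Nat.one_le_iff_ne_zero.mpr (Nat.mul_ne_zero
          (Nat.pos_iff_ne_zero.mp (hpow _)) (Nat.pos_iff_ne_zero.mp (hpow _)))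
      by_cases hvi : v ∈ Q i
      · have h1 := hrect_in j i hj hvi
        have h2 := hH j i
        have hb' : b' i = b i - 1 := by simp only [hb'_def, if_pos hvi]
        have h3 : p ^ b i = p ^ (b i - 1) * p := by
          rw [← pow_succ, Nat.sub_add_cancel (hb1 i hvi)]
        rw [← h1, h3, ← mul_assoc] at h2
        rw [hb']
        exact Nat.le_of_mul_le_mul_right h2 hp.pos
      · have hb' : b' i = b i := by simp only [hb'_def, if_neg hvi]
        rw [hrect_out j i hj hvi, hb']
        exact hH j i
    obtain ⟨Yb, hYbα, hYbβ⟩ := ih _ hlt (C ⧸ N) Pb Qb a b' hCbar hPba hQba hHb rfl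
    set Y : AddSubgroup C := Yb.comap mk with hY_def
    have hNY : N ≤ Y := by
      intro n hn
      rw [hY_def, AddSubgroup.mem_comap, hmk_def, QuotientAddGroup.mk'_apply,
        (QuotientAddGroup.eq_zero_iff n).mpr hn]
      exact Yb.zero_mem
    refine ⟨Y, fun j ↦ ?_, fun i ↦ ?_⟩
    · by_cases hj : P j = ⊥
      · rw [hj, inf_bot_eq, AddSubgroup.card_bot, mul_one]; exact hpow _
      have h1 : Nat.card ↥(P j) = Nat.card ↥(Pb j) * p := by
        rw [← hcardN]; exact (card_map_mk_mul_card (hNle j hj)).symm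
      have h2 : Nat.card ↥(Y ⊓ P j) = Nat.card ↥(Yb ⊓ Pb j) * p := by
        rw [← hcardN, ← card_map_mk_mul_card (le_inf hNY (hNle j hj)), hY_def, hmk_def,
          map_comap_inf_eq]
      rw [h1, h2]
      calc Nat.card ↥(Pb j) * p ≤ p ^ a j * Nat.card ↥(Yb ⊓ Pb j) * p :=
            Nat.mul_le_mul_right _ (hYbα j)
        _ = p ^ a j * (Nat.card ↥(Yb ⊓ Pb j) * p) := by ring
    · by_cases hvi : v ∈ Q i
      · have h1 : Nat.card ↥(Y ⊓ Q i) = Nat.card ↥(Yb ⊓ Qb i) * p := by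
          rw [← hcardN, ← card_map_mk_mul_card (le_inf hNY (AddSubgroup.zmultiples_le_of_mem hvi)),
            hY_def, hmk_def, map_comap_inf_eq]
        have h2 := hYbβ i
        have hb' : b' i = b i - 1 := by simp only [hb'_def, if_pos hvi]
        rw [hb'] at h2
        rw [h1, ← Nat.sub_add_cancel (hb1 i hvi), pow_succ]
        exact Nat.mul_le_mul_right _ h2
      · have hdisj : Disjoint N (Y ⊓ Q i) :=
          disjoint_zmultiples_of_not_mem hp hpv (fun h ↦ hvi (AddSubgroup.mem_inf.mp h).2)
        have h1 : Nat.card ↥(Y ⊓ Q i) = Nat.card ↥((Y ⊓ Q i).map mk) :=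
          (card_map_mk_of_disjoint hdisj).symm
        have h2 : (Y ⊓ Q i).map mk ≤ Yb ⊓ Qb i :=
          le_inf ((AddSubgroup.map_mono inf_le_left).trans (AddSubgroup.map_comap_le _ _))
            (AddSubgroup.map_mono inf_le_right)
        have hb' : b' i = b i := by simp only [hb'_def, if_neg hvi]
        rw [h1, ← hb']
        exact (AddSubgroup.card_le_of_le h2).trans (hYbβ i)

end Threading

end Summit.BirchSwinnertonDyer.BirchSwinnertonDyer.Theorems.KolyvaginLiftGroupsTwo

end
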